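import Summits.ABC.StewartYu.PadicG3TwoScheduleS
import Summits.ABC.StewartYu.PadicG3TwoLogForm
import Summits.ABC.StewartYu.FeldmanDenValuation
import HarnessLib

/-!
# Cell abc-stewartyu, Gen-3 frame at `p = 2` (crux `Y07Two`, stmt-ABC-19659), record interface: CLOSED-FORM SIZES of
# the slots of the schedule of record `schedTwoS` (weights, Hasse sizes, Siegel coefficient bound, Liouville constant)

`Summits/ABC/StewartYu/PadicG3TwoSizes.lean` — cell `abc-stewartyu` (HOME `run/shared/lean/pub/abc-stewartyu/`),
route `PadicPrimesKummerThird`, seat p5 (g3).  Theorems only: every abstract slot of `schedTwoS S P` that enters the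
budget lines (L2)/(L3) bounded by an explicit real in the letters of `P : PadicG3Par (d+1)` and the heights
`h(αⱼ)`, `h(θ)` — the frame side of p1's «size ≤ allowance» contract (`PadicG3ParD`, WHAT THIS IS NOT).

* `Bw3_le` / `log_Bw3_le`: `Bw3 ≤ (8·2^m)^{L₀}`, `log Bw3 ≤ L₀·(m+3)·log 2` (`‖den(ℓ,H)⁻¹‖₂ ≤ 2^ℓ`,
  `FeldmanDenValuation`);
* `feldSize` / `M₀3_le_two_mul` / `log_M₀3_le`: `log M₀3 I x τ ≤ log 2 + (I*−I)·t·log 3 + t·log ν(H) + H/e +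
  L₀·(1 + log(1 + 3^{I*−I}|x|/H))`, monotone in `|x|` and `t`;
* `log_M₀E3_le`, `log_Amax3_le`: the level-`0` Siegel sizes (`|x| ≤ X`, `t ≤ T03 0`);
* `log_cardB_schedTwoS`, `log_P_schedTwoS_le`: `log #box`, `log P ≤ log #box + log Amax3 + log 2`;
* `log_KTwo_schedTwoS_le`: the Liouville constant of the k-steps assembled from the above and the far-height line
  `2·log monDen ≤ 4|x|·(∑ⱼ Dbox3R I j·h(αⱼ) + Dθ3R I·h(θ))` (`PadicG3TwoLogForm.log_monDen_boxExp_le`).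

WHAT THIS IS NOT: the comparison with the budget unit `Z = G·X·L` (record, p1); no crux moves.

References: Yu. V. Nesterenko, LNM 1819 (2003), §3.1 Prop 3.1, §4.2 (4.19)–(4.35); K. Yu, Acta Math. 211 (2013), §3.1.
-/

noncomputable section

open Finset Real
open Literature.NumberTheory.Transcendental
open Literature.NumberTheory.Transcendental (FeldmanDelta.den)
open Literature.NumberTheory.Transcendental.FeldmanDelta
open Literature.NumberTheory.Transcendental.CW77.Setup (Tau tauNorm)

namespace Summit.ABC.StewartYu

namespace TwoSetup

open Summit.ABC.StewartYu.G3Boxes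

variable (S : TwoSetup) (P : PadicG3Par (S.d + 1))

/-! ### The `2`-adic weight slot -/

/-- **`Bw3 ≤ (8·2^m)^{L₀}`.** [cite: Nesterenko2003, §3.1 (3.5)–(3.6); shape only] -/
theorem Bw3_le : S.Bw3 P ≤ (8 * (2 : ℝ) ^ P.m) ^ P.L₀ := by
  have hH : 1 ≤ P.H := le_max_left _ _
  unfold Bw3
  refine Finset.sup'_le _ _ fun ℓ hℓ => ?_
  have hℓ' : ℓ ≤ P.L₀ := by have := Finset.mem_range.mp hℓ; omega
  have h1 : ‖((den ℓ P.H : ℚ_[2]))⁻¹‖ ≤ (2 : ℝ) ^ ℓ := FeldmanDen.norm_inv_den_two_le ℓ hH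
  have h8 : (1 : ℝ) ≤ 8 * (2 : ℝ) ^ P.m := by
    have : (1 : ℝ) ≤ (2 : ℝ) ^ P.m := one_le_pow₀ (by norm_num)
    linarith
  calc ‖((den ℓ P.H : ℚ_[2]))⁻¹‖ * (4 * (2 : ℝ) ^ P.m) ^ ℓ ≤ (2 : ℝ) ^ ℓ * (4 * (2 : ℝ) ^ P.m) ^ ℓ := by
        gcongr
    _ = (8 * (2 : ℝ) ^ P.m) ^ ℓ := by rw [← mul_pow]; ring
    _ ≤ (8 * (2 : ℝ) ^ P.m) ^ P.L₀ := pow_le_pow_right₀ h8 hℓ'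

/-- `0 < Bw3`. [folklore] -/
theorem Bw3_pos : 0 < S.Bw3 P := by
  have h := S.Bw3_ge P 0 (Nat.zero_le _)
  rw [pow_zero, mul_one] at h
  exact lt_of_lt_of_le (by rw [norm_pos_iff]; exact inv_ne_zero (by exact_mod_cast den_ne_zero 0 P.H)) h

/-- **`log Bw3 ≤ L₀·(m+3)·log 2`.** [cite: Nesterenko2003, §3.1 (3.5)–(3.6); shape only] -/
theorem log_Bw3_le : Real.log (S.Bw3 P) ≤ P.L₀ * ((P.m + 3) * Real.log 2) := by
  have h := Real.log_le_log (S.Bw3_pos P) (S.Bw3_le P)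
  refine h.trans (le_of_eq ?_)
  rw [Real.log_pow, Real.log_mul (by norm_num) (by positivity), Real.log_pow,
    show (8 : ℝ) = 2 ^ 3 by norm_num, Real.log_pow]
  push_cast
  ring

/-! ### The Hasse sizes -/

/-- The real Fel'dman size at level `I`, point size `r`, order `t`:
`3^{(I*−I)t}·ν(H)^t·e^{H/e}·(e(1+3^{I*−I}r/H))^{L₀}`. [cite: Nesterenko2003, §3.1 Prop 3.1; shape only] -/
def feldSize (I : ℕ) (r : ℝ) (t : ℕ) : ℝ :=
  (3 : ℝ) ^ ((S.Istar3 P - I) * t) * ((Nat.lcmUpto P.H : ℝ) ^ t *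
    (Real.exp (P.H / Real.exp 1) * (Real.exp 1 * (1 + (3 : ℝ) ^ (S.Istar3 P - I) * r / P.H)) ^ P.L₀))

/-- `1 ≤ feldSize` for `r ≥ 0`. [folklore] -/
theorem one_le_feldSize (I : ℕ) {r : ℝ} (hr : 0 ≤ r) (t : ℕ) : 1 ≤ S.feldSize P I r t := by
  unfold feldSize
  have h3 : (1 : ℝ) ≤ (3 : ℝ) ^ ((S.Istar3 P - I) * t) := one_le_pow₀ (by norm_num)
  have hν : (1 : ℝ) ≤ (Nat.lcmUpto P.H : ℝ) ^ t := one_le_pow₀ (by exact_mod_cast Nat.lcmUpto_pos P.H)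
  have he : (1 : ℝ) ≤ Real.exp (P.H / Real.exp 1) := Real.one_le_exp (by positivity)
  have hb : (1 : ℝ) ≤ (Real.exp 1 * (1 + (3 : ℝ) ^ (S.Istar3 P - I) * r / P.H)) ^ P.L₀ := by
    refine one_le_pow₀ ?_
    have h1 : (1 : ℝ) ≤ Real.exp 1 := Real.one_le_exp zero_le_one
    have h2 : (0 : ℝ) ≤ (3 : ℝ) ^ (S.Istar3 P - I) * r / P.H := by positivity
    nlinarith
  calc (1 : ℝ) = 1 * (1 * (1 * 1)) := by ring
    _ ≤ _ := by gcongr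

/-- `feldSize` is monotone in the point size and the order. [folklore] -/
theorem feldSize_mono (I : ℕ) {r r' : ℝ} (hr : 0 ≤ r) (hrr : r ≤ r') {t t' : ℕ} (htt : t ≤ t') :
    S.feldSize P I r t ≤ S.feldSize P I r' t' := by
  unfold feldSize
  have hν1 : (1 : ℝ) ≤ (Nat.lcmUpto P.H : ℝ) := by exact_mod_cast Nat.lcmUpto_pos P.H
  have he1 : (1 : ℝ) ≤ Real.exp 1 := Real.one_le_exp zero_le_one
  gcongr
  norm_num

/-- **`M₀3 I x τ ≤ 2·feldSize I |x| τ.1`** (the ceiling costs a factor `≤ 2`). [folklore] -/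
theorem M₀3_le_two_mul (I : ℕ) (x : ℤ) (τ : Tau S.d) :
    (S.M₀3 P I x τ : ℝ) ≤ 2 * S.feldSize P I |(x : ℝ)| τ.1 := by
  have h1 := S.one_le_feldSize P I (abs_nonneg (x : ℝ)) τ.1
  have hc : (S.M₀3 P I x τ : ℝ) < S.feldSize P I |(x : ℝ)| τ.1 + 1 := by
    unfold M₀3 feldSize
    exact Int.ceil_lt_add_one _
  linarith

/-- `1 ≤ M₀3 I x τ`. [folklore] -/
theorem one_le_M₀3 (I : ℕ) (x : ℤ) (τ : Tau S.d) : (1 : ℝ) ≤ (S.M₀3 P I x τ : ℝ) := by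
  have h := S.M₀3_ge P I x τ 0 (Nat.zero_le _)
  rw [pow_zero, mul_one] at h
  refine le_trans ?_ h
  have h3 : (1 : ℝ) ≤ (3 : ℝ) ^ ((S.Istar3 P - I) * τ.1) := one_le_pow₀ (by norm_num)
  have hν : (1 : ℝ) ≤ (Nat.lcmUpto P.H : ℝ) ^ τ.1 := one_le_pow₀ (by exact_mod_cast Nat.lcmUpto_pos P.H)
  have he : (1 : ℝ) ≤ Real.exp (P.H / Real.exp 1) := Real.one_le_exp (by positivity)
  calc (1 : ℝ) = 1 * (1 * 1) := by ring
    _ ≤ _ := by gcongr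

/-- **`log feldSize`** in closed form (`log(1+y) ` kept). [cite: Nesterenko2003, §3.1 (3.4)–(3.8); shape only] -/
theorem log_feldSize (I : ℕ) {r : ℝ} (hr : 0 ≤ r) (t : ℕ) :
    Real.log (S.feldSize P I r t) = ((S.Istar3 P - I) * t : ℕ) * Real.log 3 + t * Real.log (Nat.lcmUpto P.H) +
      P.H / Real.exp 1 + P.L₀ * (1 + Real.log (1 + (3 : ℝ) ^ (S.Istar3 P - I) * r / P.H)) := by
  unfold feldSize
  have hν : (0 : ℝ) < (Nat.lcmUpto P.H : ℝ) := by exact_mod_cast Nat.lcmUpto_pos P.H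
  have hy : (0 : ℝ) < 1 + (3 : ℝ) ^ (S.Istar3 P - I) * r / P.H := by positivity
  rw [Real.log_mul (by positivity) (by positivity), Real.log_mul (by positivity) (by positivity),
    Real.log_mul (by positivity) (by positivity), Real.log_pow, Real.log_pow, Real.log_exp, Real.log_pow,
    Real.log_mul (by positivity) hy.ne', Real.log_exp]
  ring

/-- **`log M₀3 I x τ ≤ log 2 + log feldSize I r t`** for `|x| ≤ r`, `τ.1 ≤ t`. [folklore] -/
theorem log_M₀3_le (I : ℕ) {x : ℤ} {r : ℝ} (hx : |(x : ℝ)| ≤ r) {τ : Tau S.d} {t : ℕ} (ht : τ.1 ≤ t) :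
    Real.log (S.M₀3 P I x τ : ℝ) ≤ Real.log 2 + Real.log (S.feldSize P I r t) := by
  have h1 := S.one_le_M₀3 P I x τ
  have h2 := (S.M₀3_le_two_mul P I x τ).trans
    (mul_le_mul_of_nonneg_left (S.feldSize_mono P I (abs_nonneg _) hx ht) (by norm_num))
  have hf := S.one_le_feldSize P I ((abs_nonneg (x : ℝ)).trans hx) t
  rw [← Real.log_mul (by norm_num) (by linarith)]
  exact Real.log_le_log (by linarith) h2

/-! ### The level-`0` Siegel sizes -/

/-- **`log M₀E3 ≤ log 2 + log feldSize 0 X (T03 0)`.** [folklore] -/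
theorem log_M₀E3_le :
    Real.log (S.M₀E3 P (S.one_le_T03 P 0) : ℝ) ≤ Real.log 2 + Real.log (S.feldSize P 0 P.X (S.T03 P 0)) := by
  obtain ⟨e, he, heq'⟩ := Finset.exists_mem_eq_sup' (eqSet_nonempty S.d P.X (S.one_le_T03 P 0))
    (fun e : ℤ × Tau S.d => S.M₀3 P 0 e.1 e.2)
  unfold M₀E3
  rw [heq']
  have hm := mem_eqSet.mp he
  refine S.log_M₀3_le P 0 (by exact_mod_cast hm.1) ?_
  have : e.2.1 ≤ tauNorm e.2 := by unfold tauNorm; omega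
  omega

/-- `1 ≤ M₀E3`. [folklore] -/
theorem one_le_M₀E3 : (1 : ℝ) ≤ (S.M₀E3 P (S.one_le_T03 P 0) : ℝ) := by
  obtain ⟨e, he⟩ := eqSet_nonempty S.d P.X (S.one_le_T03 P 0)
  have h := S.M₀3_le_M₀E3 P (S.one_le_T03 P 0) he
  exact (S.one_le_M₀3 P 0 e.1 e.2).trans (by exact_mod_cast h)

/-- The level-`0` far-height unit `hbox0 = ∑ⱼ Dbox3 0 j·h(αⱼ) + Dθ3 0·h(θ)`. [folklore] -/
def hbox0 : ℝ := ∑ j, (S.Dbox3 P 0 j : ℝ) * Height.logHeight₁ (S.α j) + (S.Dθ3 P 0 : ℝ) * Height.logHeight₁ S.θ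

/-- `0 ≤ hbox0`. [folklore] -/
theorem hbox0_nonneg : 0 ≤ S.hbox0 P := by
  unfold hbox0
  have : ∀ j, 0 ≤ Height.logHeight₁ (S.α j) := fun j => Height.zero_le_logHeight₁ _
  have hθ : 0 ≤ Height.logHeight₁ S.θ := Height.zero_le_logHeight₁ _
  positivity

/-- **`log Amax3 ≤ log M₀E3 + T03 0·log Xb3 0 + 4X·hbox0`.** [cite: Yu2013, (4.28); shape only] -/
theorem log_Amax3_le :
    Real.log (S.Amax3 P (S.one_le_T03 P 0)) ≤ Real.log (S.M₀E3 P (S.one_le_T03 P 0) : ℝ) +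
      (S.T03 P 0 : ℝ) * Real.log (S.Xb3 P 0 : ℝ) + 4 * (P.X : ℝ) * S.hbox0 P := by
  have hM := S.one_le_M₀E3 P
  have hXb1 : (1 : ℝ) ≤ (S.Xb3 P 0 : ℝ) := by exact_mod_cast S.one_le_Xb3 P 0
  have hh := S.hbox0_nonneg P
  have hR : 0 ≤ Real.log (S.M₀E3 P (S.one_le_T03 P 0) : ℝ) + (S.T03 P 0 : ℝ) * Real.log (S.Xb3 P 0 : ℝ) +
      4 * (P.X : ℝ) * S.hbox0 P := by
    have := Real.log_nonneg hM; have := Real.log_nonneg hXb1; positivity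
  unfold Amax3
  rcases le_total ((eqSet S.d P.X (S.T03 P 0)).sup' (eqSet_nonempty S.d P.X (S.one_le_T03 P 0)) fun e =>
      (S.M₀E3 P (S.one_le_T03 P 0) : ℝ) * (S.Xb3 P 0 : ℝ) ^ (∑ j, e.2.2 j) *
        ((MonomialDen.monDen S.toQ.all (S.boxExp (S.Dbox3 P 0) (S.Dθ3 P 0) e.1) : ℝ)) ^ 2) 1 with h1 | h1
  · rw [max_eq_left h1, Real.log_one]; exact hR
  · rw [max_eq_right h1]
    obtain ⟨e, he, heq'⟩ := Finset.exists_mem_eq_sup' (eqSet_nonempty S.d P.X (S.one_le_T03 P 0))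
      (fun e : ℤ × Tau S.d => (S.M₀E3 P (S.one_le_T03 P 0) : ℝ) * (S.Xb3 P 0 : ℝ) ^ (∑ j, e.2.2 j) *
        ((MonomialDen.monDen S.toQ.all (S.boxExp (S.Dbox3 P 0) (S.Dθ3 P 0) e.1) : ℝ)) ^ 2)
    rw [heq']
    have hm := mem_eqSet.mp he
    have hmon1 : (1 : ℝ) ≤ (MonomialDen.monDen S.toQ.all (S.boxExp (S.Dbox3 P 0) (S.Dθ3 P 0) e.1) : ℝ) := by
      exact_mod_cast MonomialDen.one_le_monDen _ S.toQ.all_ne _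
    rw [Real.log_mul (by positivity) (by positivity), Real.log_mul (by positivity) (by positivity),
      Real.log_pow, Real.log_pow]
    have hsum : ((∑ j, e.2.2 j : ℕ) : ℝ) ≤ S.T03 P 0 := by
      have : ∑ j, e.2.2 j ≤ tauNorm e.2 := by unfold tauNorm; omega
      exact_mod_cast (this.trans hm.2.le)
    have hlogmon := S.log_monDen_boxExp_le (S.Dbox3 P 0) (S.Dθ3 P 0) e.1
    have hx : |(e.1 : ℝ)| ≤ P.X := by exact_mod_cast hm.1
    have h2 : 2 * |(e.1 : ℝ)| * S.hbox0 P ≤ 2 * (P.X : ℝ) * S.hbox0 P := by gcongr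
    unfold hbox0 at h2 hlogmon
    have hXlog := Real.log_nonneg hXb1
    have ht : ((∑ j, e.2.2 j : ℕ) : ℝ) * Real.log (S.Xb3 P 0 : ℝ) ≤ (S.T03 P 0 : ℝ) * Real.log (S.Xb3 P 0 : ℝ) :=
      mul_le_mul_of_nonneg_right hsum hXlog
    unfold hbox0
    push_cast at ht ⊢
    linarith [hlogmon, h2, ht]

/-! ### The Liouville constant of the k-steps -/

/-- **`log #box`** of the schedule. [folklore] -/
theorem log_cardB_schedTwoS (I : ℕ) :
    Real.log ((S.schedTwoS P).cardB I : ℝ) = Real.log ((P.L₀ + 1 : ℕ) : ℝ) +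
      (∑ j, Real.log ((2 * S.Dbox3 P 0 j + 1 : ℕ) : ℝ) + Real.log ((2 * S.Dθ3 P 0 + 1 : ℕ) : ℝ)) := by
  rw [schedTwoS_cardB, card_famBox]
  push_cast
  rw [Real.log_mul (by positivity) (by positivity), Real.log_mul (by positivity) (by positivity),
    Real.log_prod (s := Finset.univ) (fun j _ => by positivity)]

/-- **`log P ≤ log #box + log Amax3 + log 2`** for the coefficient slot of the schedule. [folklore] -/
theorem log_P_schedTwoS_le :
    Real.log ((S.schedTwoS P).P : ℝ) ≤ Real.log ((S.schedTwoS P).cardB 0 : ℝ) +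
      Real.log (S.Amax3 P (S.one_le_T03 P 0)) + Real.log 2 := by
  rw [schedTwoS_P, schedTwoS_cardB]
  set c : ℝ := ((famBox P.L₀ (S.Dbox3 P 0) (S.Dθ3 P 0)).card : ℝ) with hc
  set A : ℝ := S.Amax3 P (S.one_le_T03 P 0) with hA
  have hc1 : (1 : ℝ) ≤ c := by
    rw [hc, card_famBox]; exact_mod_cast Nat.one_le_iff_ne_zero.mpr (by positivity)
  have hA1 : (1 : ℝ) ≤ A := le_max_left _ _
  have hcA : (1 : ℝ) ≤ c * A := one_le_mul_of_one_le_of_one_le hc1 hA1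
  have hceil : ((⌈c * A⌉ : ℤ) : ℝ) ≤ 2 * (c * A) := by
    have := Int.ceil_lt_add_one (c * A); linarith
  have hpos : (0 : ℝ) < ((⌈c * A⌉ : ℤ) : ℝ) := by
    have : (1 : ℤ) ≤ ⌈c * A⌉ := Int.one_le_ceil_iff.mpr (by linarith)
    exact_mod_cast this
  rw [← Real.log_mul (by positivity) (by positivity), ← Real.log_mul (by positivity) (by norm_num)]
  exact Real.log_le_log hpos (by linarith)

/-- The far-height unit at level `I`: `hboxR I = ∑ⱼ Dbox3R I j·h(αⱼ) + Dθ3R I·h(θ)` (`→ 0` with the boxes). [folklore] -/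
def hboxR (I : ℕ) : ℝ :=
  ∑ j, (S.Dbox3R P I j : ℝ) * Height.logHeight₁ (S.α j) + (S.Dθ3R P I : ℝ) * Height.logHeight₁ S.θ

/-- **`log KTwo` of the schedule of record, closed form**:
`log KTwo I x τ ≤ log #box + (log #box + log Amax3 + log 2) + (log 2 + log feldSize I |x| τ.1) + |t|·log Xb3R I +
4|x|·hboxR I`. [cite: Nesterenko2003, §4.2 (4.24)–(4.35); shape only] -/
theorem log_KTwo_schedTwoS_le (I : ℕ) (x : ℤ) (τ : Tau S.d) :
    Real.log (KTwo (S.schedTwoS P) I x τ) ≤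
      Real.log ((S.schedTwoS P).cardB I : ℝ) +
        (Real.log ((S.schedTwoS P).cardB 0 : ℝ) + Real.log (S.Amax3 P (S.one_le_T03 P 0)) + Real.log 2) +
        (Real.log 2 + Real.log (S.feldSize P I |(x : ℝ)| τ.1)) +
        (∑ j, τ.2 j : ℕ) * Real.log (S.Xb3R P I : ℝ) + 4 * |(x : ℝ)| * S.hboxR P I := by
  have hc : 0 < (S.schedTwoS P).cardB I := by rw [schedTwoS_cardB, card_famBox]; positivity
  have hP : 0 < (S.schedTwoS P).P := by
    rw [schedTwoS_P]
    have hc1 : (1 : ℝ) ≤ ((famBox P.L₀ (S.Dbox3 P 0) (S.Dθ3 P 0)).card : ℝ) := by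
      rw [card_famBox]; exact_mod_cast Nat.one_le_iff_ne_zero.mpr (by positivity)
    have hA1 : (1 : ℝ) ≤ S.Amax3 P (S.one_le_T03 P 0) := le_max_left _ _
    exact Int.one_le_ceil_iff.mpr (by nlinarith)
  have hM : 0 < (S.schedTwoS P).M₀ I x τ := by
    rw [schedTwoS_M₀]; exact_mod_cast (S.one_le_M₀3 P I x τ)
  have hXb : 0 < (S.schedTwoS P).Xb I := by rw [schedTwoS_Xb]; have := S.one_le_Xb3R P I; omega
  rw [log_KTwo_eq (S.schedTwoS P) I x τ hc hP hM hXb]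
  have h1 := S.log_P_schedTwoS_le P
  have h2 : Real.log ((S.schedTwoS P).M₀ I x τ : ℝ) ≤ Real.log 2 + Real.log (S.feldSize P I |(x : ℝ)| τ.1) := by
    rw [schedTwoS_M₀]; exact S.log_M₀3_le P I le_rfl le_rfl
  have h3 : 2 * Real.log (MonomialDen.monDen S.toQ.all
      (S.boxExp ((S.schedTwoS P).Dbox I) ((S.schedTwoS P).Dθ I) x) : ℝ) ≤ 4 * |(x : ℝ)| * S.hboxR P I := by
    rw [schedTwoS_Dbox, schedTwoS_Dθ]
    have := S.log_monDen_boxExp_le (S.Dbox3R P I) (S.Dθ3R P I) x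
    unfold hboxR
    linarith
  rw [schedTwoS_Xb]
  linarith

end TwoSetup

end Summit.ABC.StewartYu

end
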